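import Summits.BirchSwinnertonDyer.BirchSwinnertonDyer.Theorems.PrintCf2RubinValueTwoGoodTwistDictJunction
import Summits.BirchSwinnertonDyer.BirchSwinnertonDyer.Theorems.PrintCf2SplitBadTwoAvatarValuesTwo
import Literature.NumberTheory.EllipticCurves.FineSelmerLimThm35AtTwoUpstairsProofs
import HarnessLib

/-!
# Route C `PrintCf2RubinValueTwo`, crux `GoodTwistDictionaryAtTwo` (stmt-BirchSwinnertonDyer-23295), PART 2 / F4b:
# ASSEMBLY KIT — `ℚ₂`-rationality of Deuring values, avatars of products, the ramification bookkeeping, signs on `Υ`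

Cell `bsd-print-cf2`, width seat `bsd-line-cf2c-w2` g9 (prover-bsd-line-cf2c-w2-g9-0); Theses-free helper
`--supports stmt-BirchSwinnertonDyer-23295`. THEOREMS ONLY (no `def`, no named fact, no `sorry`); print-free; nothing about BSD is asserted;
no summit statement is proved by this seat; BSD is not proved by any of this.

Small lemmas the closer of the good-twist dictionary strings together:
* §1 `eventually_symm_valueAtUniformizer_mem_range` (+ `_galConj_`): a character whose values at the unramified places are `σ₀(α_w)`,
  `α_w ∈ 𝓞_K`, `K ∋ √−7` quadratic, has `ι⁻¹(φ(ϖ_w)) ∈ ℚ₂` for almost all `w` (so its avatar is `ℤ₂ˣ`-valued, `exists_padicInt_avatarValueAt`).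
* §2 `isPAdicAvatarOf_of_mul_inv`: avatars `e∘χ_ψ` of `ψ` and `e∘χ_g` of `ψ′ψ⁻¹` give the avatar `e∘(χ_ψ χ_g)` of `ψ′`.
* §3 ramification: `isUnramifiedAt_iff_of_twist` (`ψ′` vs `ψ` off `2` when `ψ′ψ⁻¹` has an unramified avatar), `isUnramifiedAt_thetaK_iff`
  (`θK` vs `ψ∘c` off `2` for a quadratic-part datum), `mem_iff_not_isUnramifiedAt` (the exact-tame-set clause from these), `intCast_notMem_of_two_notMem`.
* §4 signs on `Υ`: `coe_eq_coe_cyc_of_sign` (the sign character of `√ε`, `ε ∈ {−1,−2}`, agrees with `χ_cyc` on `Υ`), `coe_cyc_sq_eq_one`,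
  `coe_sq_eq_one_of_padicInt`, `units_eq_one_of_sign_two` (the sign character of `√2` dies on `Υ`).

References: [SerreAbelianLadic1968] Ch. II §2.7, Ch. III §2.3; [SilvermanATAEC1994] Ch. II Thm. 9.2, Cor. 10.4.1; [Washington1997] Prop. 13.2,
Thm. 13.4; [Serre1973] Ch. II §3.3.
-/

set_option autoImplicit false
-- D-0017 layout: summit = sub-problem, so `Summit.BirchSwinnertonDyer.BirchSwinnertonDyer.…` repeats a path component.
set_option linter.dupNamespace false

noncomputable section

open scoped Classical
open NumberField IsDedekindDomain Field WeierstrassCurve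
open Literature Literature.NumberTheory.GaloisRepresentations Literature.NumberTheory.EllipticCurves
open Literature.NumberTheory.EllipticCurves.Rank1Residual
open Summit.BirchSwinnertonDyer.BirchSwinnertonDyer.Theorems.PrintCf2.GoodTwistDictPairSigns
open Summit.BirchSwinnertonDyer.BirchSwinnertonDyer.Theorems.PrintCf2.GoodTwistDictJunction

namespace Summit.BirchSwinnertonDyer.BirchSwinnertonDyer.Theorems.PrintCf2.GoodTwistDictKit

variable {K : Type} [Field K] [NumberField K]

/-! ## §1 `ℚ₂`-rationality of the values and `ℤ₂ˣ`-valued avatars -/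

/-- If `φ(ϖ_w) = σ₀(α_w)`, `α_w ∈ 𝓞_K`, at every unramified `w` (`K` quadratic with `√−7 ∈ K`), then `ι⁻¹(φ(ϖ_w)) ∈ ℚ₂` for almost all `w`.
[cite: SilvermanATAEC1994, Ch. II Thm. 9.2, Cor. 10.4.1] [cite: Serre1973, Ch. II §3.3 Thm. 4] -/
theorem eventually_symm_valueAtUniformizer_mem_range (hK2 : Module.finrank ℚ K = 2) {θ : K} (hθ : θ ^ 2 = -7)
    (ι : PadicAlgCl 2 ≃+* ℂ) {φ : HeckeCharacter K} {σ₀ : K →+* ℂ}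
    (hval : ∀ w : HeightOneSpectrum (𝓞 K), φ.IsUnramifiedAt w → ∃ α : 𝓞 K, φ.valueAtUniformizer w = σ₀ α) :
    ∀ᶠ w : HeightOneSpectrum (𝓞 K) in Filter.cofinite,
      ι.symm (φ.valueAtUniformizer w) ∈ Set.range (algebraMap ℚ_[2] (PadicAlgCl 2)) := by
  refine (HeckeCharacter.isUnramifiedAt_cofinite_holds φ).mono fun w hw ↦ ?_
  obtain ⟨α, hα⟩ := hval w hw
  rw [hα]
  exact QuadraticPart.ringHom_apply_mem_range_algebraMap_two hK2 hθ ((ι.symm : ℂ ≃+* PadicAlgCl 2).toRingHom.comp σ₀) (α : K)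

/-- The same for `φ ∘ c` (`(φ∘c)(ϖ_w) = φ(ϖ_{cw})` at the cofinitely many `w` with `φ` unramified at `c w`).
[cite: SilvermanATAEC1994, Ch. II Thm. 9.2, Cor. 10.4.1] [cite: Serre1973, Ch. II §3.3 Thm. 4] -/
theorem eventually_symm_valueAtUniformizer_galConj_mem_range (hK2 : Module.finrank ℚ K = 2) {θ : K} (hθ : θ ^ 2 = -7)
    (ι : PadicAlgCl 2 ≃+* ℂ) (c : K ≃ₐ[ℚ] K) {φ : HeckeCharacter K} {σ₀ : K →+* ℂ}
    (hval : ∀ w : HeightOneSpectrum (𝓞 K), φ.IsUnramifiedAt w → ∃ α : 𝓞 K, φ.valueAtUniformizer w = σ₀ α) :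
    ∀ᶠ w : HeightOneSpectrum (𝓞 K) in Filter.cofinite,
      ι.symm ((HeckeCharacter.galConj c φ).valueAtUniformizer w) ∈ Set.range (algebraMap ℚ_[2] (PadicAlgCl 2)) := by
  have hinj : Function.Injective fun w : HeightOneSpectrum (𝓞 K) ↦ c • w := MulAction.injective c
  refine (hinj.tendsto_cofinite.eventually (HeckeCharacter.isUnramifiedAt_cofinite_holds φ)).mono fun w hw ↦ ?_
  obtain ⟨α, hα⟩ := hval (c • w) hw
  rw [HeckeCharacter.valueAtUniformizer_galConj_of_isUnramifiedAt c φ w hw, hα]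
  exact QuadraticPart.ringHom_apply_mem_range_algebraMap_two hK2 hθ ((ι.symm : ℂ ≃+* PadicAlgCl 2).toRingHom.comp σ₀) (α : K)

/-- **(G) in the item's currency**: an avatar `e∘χ` of a character with almost all values in `ℚ₂` is `ℤ₂ˣ`-valued —
`∃ χ′ : Γ_K →ₜ* ℤ₂ˣ` with `χ′(σ) = (e∘χ)(σ)` in `ℂ₂`. [cite: SerreAbelianLadic1968, Ch. II §2.7, Ch. III §2.3] -/
theorem exists_padicInt_avatarValueAt (ι : PadicAlgCl 2 ≃+* ℂ) {φ : HeckeCharacter K}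
    {χ : absoluteGaloisGroup K →ₜ* (PadicAlgCl 2)ˣ}
    (hav : IsPAdicAvatarOf ι φ ((FramedRep.unitsContinuousMulEquivOfUnique (Fin 1) (PadicAlgCl 2) :
      (PadicAlgCl 2)ˣ →ₜ* GL (Fin 1) (PadicAlgCl 2)).comp χ))
    (hφ : ∀ᶠ w : HeightOneSpectrum (𝓞 K) in Filter.cofinite,
      ι.symm (φ.valueAtUniformizer w) ∈ Set.range (algebraMap ℚ_[2] (PadicAlgCl 2)))
    (f : absoluteGaloisGroup K →ₜ* absoluteGaloisGroup K) :
    ∃ χ' : absoluteGaloisGroup K →ₜ* ℤ_[2]ˣ, ∀ σ : absoluteGaloisGroup K,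
      ((((χ' σ : ℤ_[2]ˣ) : ℤ_[2]) : ℚ_[2]) : ℂ_[2]) =
        avatarValueAt ((FramedRep.unitsContinuousMulEquivOfUnique (Fin 1) (PadicAlgCl 2) :
          (PadicAlgCl 2)ˣ →ₜ* GL (Fin 1) (PadicAlgCl 2)).comp (χ.comp f)) σ := by
  haveI : Fact (Nat.Prime 2) := ⟨Nat.prime_two⟩
  obtain ⟨χ', hχ'⟩ := AvatarRigidity.exists_padicIntUnitsChar_of_isPAdicAvatarOf ι hav hφ
  refine ⟨χ'.comp f, fun σ ↦ ?_⟩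
  rw [Summit.BirchSwinnertonDyer.Rank1Residual.X11b.Three.LambdaSupply.avatarValueAt_unitsChar, ContinuousMonoidHom.comp_toFun,
    ContinuousMonoidHom.comp_toFun, ← unitsChar_entry χ (f σ), hχ' (f σ)]

/-! ## §2 Avatars of products -/

/-- If `e∘χ_ψ` is the avatar of `ψ` and `e∘χ_g` that of `ψ′ψ⁻¹` (`ψ′` algebraic), then `e∘(χ_ψ χ_g)` is the avatar of `ψ′`
(Frobenius entries multiply at the good places; `AvatarRigidity.isPAdicAvatarOf_of_eventually`). [cite: SerreAbelianLadic1968, Ch. I §2.3, Ch. II §2.7] -/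
theorem isPAdicAvatarOf_of_mul_inv (ι : PadicAlgCl 2 ≃+* ℂ) {ψ ψ' : HeckeCharacter K} (hψ'alg : ψ'.IsAlgebraic)
    {χψ χg : absoluteGaloisGroup K →ₜ* (PadicAlgCl 2)ˣ}
    (hψav : IsPAdicAvatarOf ι ψ ((FramedRep.unitsContinuousMulEquivOfUnique (Fin 1) (PadicAlgCl 2) :
      (PadicAlgCl 2)ˣ →ₜ* GL (Fin 1) (PadicAlgCl 2)).comp χψ))
    (hgav : IsPAdicAvatarOf ι (ψ' * ψ⁻¹) ((FramedRep.unitsContinuousMulEquivOfUnique (Fin 1) (PadicAlgCl 2) :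
      (PadicAlgCl 2)ˣ →ₜ* GL (Fin 1) (PadicAlgCl 2)).comp χg)) :
    IsPAdicAvatarOf ι ψ' ((FramedRep.unitsContinuousMulEquivOfUnique (Fin 1) (PadicAlgCl 2) :
      (PadicAlgCl 2)ˣ →ₜ* GL (Fin 1) (PadicAlgCl 2)).comp (χψ * χg)) := by
  haveI : Fact (Nat.Prime 2) := ⟨Nat.prime_two⟩
  refine AvatarRigidity.isPAdicAvatarOf_of_eventually ι hψ'alg ?_
  refine (AvatarRigidity.eventually_notMem_and_isUnramifiedAt (p := 2) ψ).mono fun w hw h2w hψ'unr 𝔓 h𝔓 Φ hΦ ↦ ?_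
  obtain ⟨-, hψunr⟩ := hw
  have hq : (ψ' * ψ⁻¹).IsUnramifiedAt w := hψ'unr.mul' hψunr.inv'
  have e1 := AvatarRigidity.entry_eq_of_isPAdicAvatarOf ι hψav h2w hψunr 𝔓 h𝔓 Φ hΦ
  have e2 := AvatarRigidity.entry_eq_of_isPAdicAvatarOf ι hgav h2w hq 𝔓 h𝔓 Φ hΦ
  rw [unitsChar_entry] at e1 e2
  have h0 : ι.symm (ψ.valueAtUniformizer w) ≠ 0 := (map_ne_zero ι.symm).mpr (HeckeCharacter.valueAtUniformizer_ne_zero' ψ w)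
  rw [unitsChar_entry, ContinuousMonoidHom.mul_apply, Units.val_mul, e1, e2, HeckeCharacter.valueAtUniformizer_mul',
    HeckeCharacter.valueAtUniformizer_inv', map_mul, map_inv₀, mul_inv, inv_inv, mul_comm _⁻¹ (ι.symm (ψ.valueAtUniformizer w)),
    ← mul_assoc, inv_mul_cancel₀ h0, one_mul]

/-! ## §3 Ramification bookkeeping -/

/-- Off `2`, if `ψ′ψ⁻¹` has an avatar unramified at `w`, then `ψ′` is unramified at `w` iff `ψ` is. [cite: SerreAbelianLadic1968, Ch. III §2.3] -/
theorem isUnramifiedAt_iff_of_twist (ι : PadicAlgCl 2 ≃+* ℂ) {ψ ψ' : HeckeCharacter K} {a b a' b' : InfinitePlace K → ℤ}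
    (hψ : ψ.HasInfinityType a b) (hψ' : ψ'.HasInfinityType a' b')
    {g : FramedGaloisRep K (PadicAlgCl 2) 1} (hgav : IsPAdicAvatarOf ι (ψ' * ψ⁻¹) g)
    {w : HeightOneSpectrum (𝓞 K)} (h2w : ((2 : ℕ) : 𝓞 K) ∉ w.asIdeal) (hg : g.IsUnramifiedAt w) :
    ψ'.IsUnramifiedAt w ↔ ψ.IsUnramifiedAt w := by
  haveI : Fact (Nat.Prime 2) := ⟨Nat.prime_two⟩
  have hq : (ψ' * ψ⁻¹).IsUnramifiedAt w :=
    GoodTwistDictN.isUnramifiedAt_of_isPAdicAvatarOf_of_isUnramifiedAt (hψ'.mul' hψ.inv) ι hgav h2w hg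
  constructor
  · intro h
    have h' := hq.inv'.mul' h
    rwa [mul_inv_rev, inv_inv, inv_mul_cancel_right] at h'
  · intro h
    have h' := hq.mul' h
    rwa [inv_mul_cancel_right] at h'

/-- Off `2`, for a quadratic-part datum (`θK² = 1`, `ρ` with an avatar through the pair, `θK⁻¹ρ = (ψ∘c)⁻¹`, `ψ` conj-equivariant of type
`(1,0)`): `θK` is unramified at `w` iff `ψ` is (`ρ` is unramified off `2`; `θK = ρ·(ψ∘c)`; `ψ∘c` unramified iff `ψ` is).
[cite: SerreAbelianLadic1968, Ch. III §2.3] [cite: Washington1997, Prop. 13.2] -/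
theorem isUnramifiedAt_thetaK_iff (ι : PadicAlgCl 2 ≃+* ℂ) {c : K ≃ₐ[ℚ] K} {ψ : HeckeCharacter K}
    (hψ : ψ.HasInfinityType (fun _ ↦ 1) (fun _ ↦ 0)) (hψc : IsHeckeConjEquivariant c ψ)
    {κ₁ κ₂ : ZpExtension K 2} {θK ρ : HeckeCharacter K} {r : FramedGaloisRep K (PadicAlgCl 2) 1}
    (hθK : θK * θK = 1) (hρr : IsPAdicAvatarOf ι ρ r) (hrpair : FactorsThroughPair κ₁ κ₂ r)
    (hρ : θK⁻¹ * ρ = (HeckeCharacter.galConj c ψ)⁻¹)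
    {w : HeightOneSpectrum (𝓞 K)} (h2w : ((2 : ℕ) : 𝓞 K) ∉ w.asIdeal) :
    θK.IsUnramifiedAt w ↔ ψ.IsUnramifiedAt w := by
  haveI : Fact (Nat.Prime 2) := ⟨Nat.prime_two⟩
  have hρeq : ρ = θK * (HeckeCharacter.galConj c ψ)⁻¹ := by rw [← hρ, mul_inv_cancel_left]
  have hρinf : ρ.HasInfinityType ((fun _ ↦ (0 : ℤ)) + -(fun _ ↦ (0 : ℤ))) ((fun _ ↦ (0 : ℤ)) + -(fun _ ↦ (1 : ℤ))) := by
    rw [hρeq]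
    exact (hasInfinityType_zero_of_isFiniteOrder (isOfFinOrder_iff_pow_eq_one.mpr ⟨2, two_pos, by rw [pow_two, hθK]⟩)).mul'
      (RubinValueTwo.hasInfinityType_galConj_of_isHeckeConjEquivariant hψc hψ).inv
  have hρunr : ρ.IsUnramifiedAt w := GoodTwistDictN.isUnramifiedAt_of_isPAdicAvatarOf_of_isUnramifiedAt hρinf ι hρr h2w
    (GoodTwistDictN.isUnramifiedAt_of_factorsThroughPair hrpair h2w)
  have hθKeq : θK = ρ * HeckeCharacter.galConj c ψ := by
    have h := hρ
    rw [inv_mul_eq_iff_eq_mul] at h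
    rw [h, inv_mul_cancel_right]
  rw [← hψc.isUnramifiedAt_galConj_iff' w]
  constructor
  · intro h
    have h' := hρunr.inv'.mul' h
    rwa [hθKeq, inv_mul_cancel_left] at h'
  · intro h
    rw [hθKeq]
    exact hρunr.mul' h

/-- **The exact-tame-set clause from the off-`2` comparison.** If every place above `2` is `v` or `v̄`, `v, v̄ ∉ S_θ`, `S_θ` is exactly the
set of ramified places of `θK` among `w ≠ v, v̄`, `ψ′` is unramified above `2`, and off `2` `ψ′` is unramified iff `θK` is, then
`w ∈ S_θ ↔ ψ′` is ramified at `w`. [folklore] -/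
theorem mem_iff_not_isUnramifiedAt {v vbar : HeightOneSpectrum (𝓞 K)}
    (hall : ∀ w : HeightOneSpectrum (𝓞 K), ((2 : ℕ) : 𝓞 K) ∈ w.asIdeal → w = v ∨ w = vbar)
    (hv : ((2 : ℕ) : 𝓞 K) ∈ v.asIdeal) (hvbar : ((2 : ℕ) : 𝓞 K) ∈ vbar.asIdeal)
    {θK ψ' : HeckeCharacter K} {Sθ : Finset (HeightOneSpectrum (𝓞 K))} (hvS : v ∉ Sθ) (hvbarS : vbar ∉ Sθ)
    (hSram : ∀ w ∈ Sθ, ¬ θK.IsUnramifiedAt w)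
    (hSunr : ∀ w : HeightOneSpectrum (𝓞 K), w ∉ Sθ → w ≠ v → w ≠ vbar → θK.IsUnramifiedAt w)
    (h2 : ∀ w : HeightOneSpectrum (𝓞 K), ((2 : ℕ) : 𝓞 K) ∈ w.asIdeal → ψ'.IsUnramifiedAt w)
    (hU : ∀ w : HeightOneSpectrum (𝓞 K), ((2 : ℕ) : 𝓞 K) ∉ w.asIdeal → (ψ'.IsUnramifiedAt w ↔ θK.IsUnramifiedAt w))
    (w : HeightOneSpectrum (𝓞 K)) : w ∈ Sθ ↔ ¬ ψ'.IsUnramifiedAt w := by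
  constructor
  · intro hw hunr
    by_cases h2w : ((2 : ℕ) : 𝓞 K) ∈ w.asIdeal
    · rcases hall w h2w with rfl | rfl
      · exact hvS hw
      · exact hvbarS hw
    · exact hSram w hw ((hU w h2w).mp hunr)
  · intro hram
    by_contra hw
    have h2w : ((2 : ℕ) : 𝓞 K) ∉ w.asIdeal := fun h ↦ hram (h2 w h)
    have hwv : w ≠ v := fun h ↦ h2w (h ▸ hv)
    have hwvbar : w ≠ vbar := fun h ↦ h2w (h ▸ hvbar)
    exact hram ((hU w h2w).mpr (hSunr w hw hwv hwvbar))

omit [NumberField K] in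
/-- For `ε ∈ {−1, −2, 2}`: `ε ∉ w` at every `w ∤ 2`. [folklore] -/
theorem intCast_notMem_of_two_notMem {ε : ℤ} (hε : ε = -1 ∨ ε = -2 ∨ ε = 2) {w : HeightOneSpectrum (𝓞 K)}
    (h2w : ((2 : ℕ) : 𝓞 K) ∉ w.asIdeal) : (ε : 𝓞 K) ∉ w.asIdeal := by
  intro h
  rcases hε with rfl | rfl | rfl
  · apply w.isPrime.ne_top
    rw [Ideal.eq_top_iff_one]
    have h1 := w.asIdeal.neg_mem h
    push_cast at h1
    rwa [neg_neg] at h1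
  · apply h2w
    have h1 := w.asIdeal.neg_mem h
    push_cast at h1
    rwa [neg_neg] at h1
  · apply h2w
    exact_mod_cast h

/-! ## §4 Signs on `Υ` -/

omit [NumberField K] in
/-- `υ • i = i` and `υ • i = −i` cannot both hold (`i² = −1`, characteristic `0`). [folklore] -/
theorem not_smul_eq_self_of_smul_eq_neg [CharZero K] {i : AlgebraicClosure K} (hi : i ^ 2 = -1) {σ : absoluteGaloisGroup K}
    (hneg : σ • i = -i) : ¬ σ • i = i := by
  intro hfix
  have h0 : i = 0 := by
    have h2 : (2 : AlgebraicClosure K) * i = 0 := by linear_combination hfix.symm.trans hneg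
    simpa using h2
  rw [h0] at hi
  norm_num at hi

/-- **The sign character of `√ε` agrees with `χ_cyc` on `Υ`** (`ε ∈ {−1,−2}`): for `υ ∈ pairKer κ₁ κ₂` (`K` imaginary quadratic, any top
generator pair), a rank-one `e∘χ_g` with `g(σ) = 1` if `σ√ε = √ε` and entries `−1` if `σ√ε = −√ε`, where on `Υ` `σ√ε = √ε ↔ σ i = i`:
`χ_g(υ) = χ_cyc(υ)` in `ℚ̄₂` (both are `−1` exactly when `υ i = −i`, -w8 g6's H′ table). [cite: Washington1997, Thm. 13.4] [cite: Serre1968, Ch. I §1.2] -/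
theorem coe_eq_coe_cyc_of_sign (hK : IsImaginaryQuadratic K) {κ₁ κ₂ : ZpExtension K 2} {γ₁ γ₂ : absoluteGaloisGroup K}
    (hγ : ZpExtension.IsTopGeneratorPair κ₁ κ₂ γ₁ γ₂) {i r₀ : AlgebraicClosure K} (hi : i ^ 2 = -1)
    (hr₀ : ∀ σ : absoluteGaloisGroup K, σ • r₀ = r₀ ∨ σ • r₀ = -r₀)
    {χg χcyc : absoluteGaloisGroup K →ₜ* (PadicAlgCl 2)ˣ}
    (hg : ∀ σ : absoluteGaloisGroup K,
      (σ • r₀ = r₀ → (FramedRep.unitsContinuousMulEquivOfUnique (Fin 1) (PadicAlgCl 2) :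
        (PadicAlgCl 2)ˣ →ₜ* GL (Fin 1) (PadicAlgCl 2)).comp χg σ = 1) ∧
      (σ • r₀ = -r₀ → ∀ i j : Fin 1, ((((FramedRep.unitsContinuousMulEquivOfUnique (Fin 1) (PadicAlgCl 2) :
        (PadicAlgCl 2)ˣ →ₜ* GL (Fin 1) (PadicAlgCl 2)).comp χg σ : GL (Fin 1) (PadicAlgCl 2)) :
          Matrix (Fin 1) (Fin 1) (PadicAlgCl 2)) i j = -1)))
    (hiff : ∀ υ ∈ ZpExtension.pairKer κ₁ κ₂, (υ • r₀ = r₀ ↔ υ • i = i))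
    (hχcyc : ∀ σ : absoluteGaloisGroup K, ((χcyc σ : (PadicAlgCl 2)ˣ) : PadicAlgCl 2) =
      algebraMap ℚ_[2] (PadicAlgCl 2) (((GaloisRep.cyclotomicCharacter K 2 σ : ℤ_[2]ˣ) : ℤ_[2]) : ℚ_[2]))
    {υ : absoluteGaloisGroup K} (hυ : υ ∈ ZpExtension.pairKer κ₁ κ₂) :
    ((χg υ : (PadicAlgCl 2)ˣ) : PadicAlgCl 2) = ((χcyc υ : (PadicAlgCl 2)ˣ) : PadicAlgCl 2) := by
  rcases HPrime.cyclotomicCharacter_eq_one_or_eq_neg_one_of_mem_pairKer hK hγ hυ with h1 | h1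
  · have hfix : υ • i = i := FineSelmerUpstairs.smul_eq_self_of_cyclotomicCharacter_eq_one i hi h1
    have hg1 : χg υ = 1 := units_eq_one_of_comp_apply_eq_one ((hg υ).1 ((hiff υ hυ).mpr hfix))
    rw [hg1, hχcyc, h1, Units.val_one, Units.val_one, PadicInt.coe_one, map_one]
  · have hneg : υ • i = -i := (HPrime.cyclotomicCharacter_eq_neg_one_iff_smul_sqrt_neg_one hK hγ hi hυ).mp h1
    have hne : ¬ υ • r₀ = r₀ := fun h ↦ not_smul_eq_self_of_smul_eq_neg hi hneg ((hiff υ hυ).mp h)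
    have hent := (hg υ).2 ((hr₀ υ).resolve_left hne) 0 0
    rw [unitsChar_entry] at hent
    rw [hent, hχcyc, h1, Units.val_neg, Units.val_one, PadicInt.coe_neg, PadicInt.coe_one, map_neg, map_one]

/-- `χ_cyc(υ)² = 1` on `Υ`. [cite: Washington1997, Thm. 13.4] -/
theorem coe_cyc_sq_eq_one (hK : IsImaginaryQuadratic K) {κ₁ κ₂ : ZpExtension K 2} {γ₁ γ₂ : absoluteGaloisGroup K}
    (hγ : ZpExtension.IsTopGeneratorPair κ₁ κ₂ γ₁ γ₂) {χcyc : absoluteGaloisGroup K →ₜ* (PadicAlgCl 2)ˣ}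
    (hχcyc : ∀ σ : absoluteGaloisGroup K, ((χcyc σ : (PadicAlgCl 2)ˣ) : PadicAlgCl 2) =
      algebraMap ℚ_[2] (PadicAlgCl 2) (((GaloisRep.cyclotomicCharacter K 2 σ : ℤ_[2]ˣ) : ℤ_[2]) : ℚ_[2]))
    {υ : absoluteGaloisGroup K} (hυ : υ ∈ ZpExtension.pairKer κ₁ κ₂) :
    ((χcyc υ : (PadicAlgCl 2)ˣ) : PadicAlgCl 2) ^ 2 = 1 := by
  rw [hχcyc]
  rcases HPrime.cyclotomicCharacter_eq_one_or_eq_neg_one_of_mem_pairKer hK hγ hυ with h1 | h1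
  · rw [h1, Units.val_one, PadicInt.coe_one, map_one, one_pow]
  · rw [h1, Units.val_neg, Units.val_one, PadicInt.coe_neg, PadicInt.coe_one, map_neg, map_one, neg_one_sq]

/-- A `ℤ₂ˣ`-valued character has `χ(υ)² = 1` on `Υ` (`χ(υ) = ±1` there, F3 §1). [cite: Washington1997, Thm. 13.4] -/
theorem coe_sq_eq_one_of_padicInt (hK : IsImaginaryQuadratic K) {κ₁ κ₂ : ZpExtension K 2} {γ₁ γ₂ : absoluteGaloisGroup K}
    (hγ : ZpExtension.IsTopGeneratorPair κ₁ κ₂ γ₁ γ₂) {χ : absoluteGaloisGroup K →ₜ* (PadicAlgCl 2)ˣ}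
    {χZ : absoluteGaloisGroup K →ₜ* ℤ_[2]ˣ}
    (hcast : ∀ σ : absoluteGaloisGroup K, ((χ σ : (PadicAlgCl 2)ˣ) : PadicAlgCl 2) =
      algebraMap ℚ_[2] (PadicAlgCl 2) (((χZ σ : ℤ_[2]ˣ) : ℤ_[2]) : ℚ_[2]))
    {υ : absoluteGaloisGroup K} (hυ : υ ∈ ZpExtension.pairKer κ₁ κ₂) :
    ((χ υ : (PadicAlgCl 2)ˣ) : PadicAlgCl 2) ^ 2 = 1 := by
  rw [hcast]
  rcases units_eq_one_or_eq_neg_one_of_mem_pairKer hK hγ χZ hυ with h1 | h1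
  · rw [h1, Units.val_one, PadicInt.coe_one, map_one, one_pow]
  · rw [h1, Units.val_neg, Units.val_one, PadicInt.coe_neg, PadicInt.coe_one, map_neg, map_one, neg_one_sq]

/-- **The sign character of `√2` dies on `Υ`** (`K(√2) ⊂ K̃_∞`, -w8 g6 `HPrime.forall_mem_pairKer_smul_sqrt_two_eq`). [cite: Washington1997, Thm. 13.4] -/
theorem units_eq_one_of_sign_two (hK : IsImaginaryQuadratic K) {κ₁ κ₂ : ZpExtension K 2} {γ₁ γ₂ : absoluteGaloisGroup K}
    (hγ : ZpExtension.IsTopGeneratorPair κ₁ κ₂ γ₁ γ₂) {s : AlgebraicClosure K} (hs : s ^ 2 = 2)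
    {A : Type*} [CommRing A] [TopologicalSpace A] [IsTopologicalRing A] {χg : absoluteGaloisGroup K →ₜ* Aˣ}
    (hg : ∀ σ : absoluteGaloisGroup K, σ • s = s →
      (FramedRep.unitsContinuousMulEquivOfUnique (Fin 1) A : Aˣ →ₜ* GL (Fin 1) A).comp χg σ = 1)
    {υ : absoluteGaloisGroup K} (hυ : υ ∈ ZpExtension.pairKer κ₁ κ₂) : χg υ = 1 :=
  units_eq_one_of_comp_apply_eq_one (hg υ (HPrime.forall_mem_pairKer_smul_sqrt_two_eq hK hγ hs υ hυ))

end Summit.BirchSwinnertonDyer.BirchSwinnertonDyer.Theorems.PrintCf2.GoodTwistDictKit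

end
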